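import Summits.QuantumFields.BalabanUV.Beta.EriceRemainderEnclosureHistoryAutonomyComparisonAgeCompositionShareAlgebra
import Summits.QuantumFields.BalabanUV.Beta.EriceRemainderEnclosureHistoryAutonomyComparisonAgeCompositionWindowShares

/-!
# EriceRemainderEnclosureHistoryAutonomyComparisonAgeCompositionThreeAgesTotalLoad — (E90c) route (N), first order: THE TOTAL WINDOW LOAD ALONG FLOWS IS AT MOST `1` — for TWO
# loaded ages `1 ≤ i < j` with `j ≤ 133·i`, and for the THREE loaded ages `{1, k₂, k₃}` of the census with `k₃ ≤ 56` — HENCE THE THREE-AGE END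
# `0 ≤ ε ≤ e` ALONG EVERY ADMISSIBLE FLOW, FOR EVERY DAMPING `0 < g ≤ 1` AND EVERY HORIZON ((E89b) `flow_nonneg_three_ages_of_window_loads` with its
# hypothesis `d + x₂ + x₃ ≤ 1` DISCHARGED): the successor target of README g80∕e89 §5(1), by the share functional of (E90a)∕(E90b)

Cell `pub-balaban`, β-function sub-cell, BINDER row D4 «RemainderConst leaves for Bałaban's split» (`HOME/BINDER-OWNERS.md`; owner lineage `b2b-balaban-beta-an4`;
this file by co-owner #2 lineage `b2b-balaban-beta-d4-p2`, generation 81), β-FLOW TEAM duty (1), FREEZE (0) honoured (def-free; nothing restated).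

HONEST FRAMING (page 1, verbatim and binding).  *"Discharging BetaPertH makes Bałaban's UV stability UNCONDITIONAL — a real constructive-QFT result; it is
NOT the continuum limit and NOT the Clay problem."*  THIS FILE DISCHARGES NOTHING OF THE KIND.  Elementary real algebra ∕ real analysis about ABSTRACT
functionals on a box ]0,γ]^ℕ with displayed floors, profiles and signs, and the FIRST-ORDER renewal objects of route (N) built from them — hypotheses of a
census, not facts; the form, signs, ages and moments of Bałaban's (1.22) limit functional are NOT PRINTED ([I] p. 298; GAPS G-t4-U2-1∕-2) and NOT asserted.
Row D4 class UNCHANGED (critical-path width 0; instance 0∕1; D4 DISCHARGE NO DATE).  HONEST DEPENDENCY: continuum YM on T⁴ ⇐ BetaPertH ∧ nine spine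
estimates (0/9 proved); BetaPertH ⇐ (D1) ∧ (D4) ∧ CAP+tail; G-an2-4 gates asym, D1 and NE2/3/4.

THE POINT (README `HOME/b2b-balaban-beta-d4-p2/g81/e90/README.md`).  (E86i)∕(E89b) give the END of route (N) for ANY profile, damping and horizon as soon
as the total undamped window load `Σ_k k·L_kh(m+k)³∕2` is `≤ 1` at every pin; generation 80 measured it `≤ 0.82` on the whole census (`k₃ ≤ 512`) and
left its proof as THE successor task.  Here it is PROVED along every admissible flow (isotone memory with floor `b > 0` dominating the profile) for two
loaded ages with ratio `≤ 133` and for the three loaded ages `1 < k₂ < k₃ ≤ 56`: each load is at most `√2∕2` times its SHARE of its own window ((E90b)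
`load_le_share`); two shares lie on the hyperbola `(1−s_i)(1−s_j) = C_{ij}²s_is_j` and the weighted absorption `X = √2x` keeps the level ratios, whence
`x_i + x_j ≤ 1` iff `(√2−1)² ≤ 2√(a_ia_j)∕a_{i+j}`, served by concavity from the pin for `j ≤ 133i` ((E90a) `pair_le_one_of_shares`); three shares are
dominated by the Markov kernel `(C₁₂, C₁₃, C₁₃∕C₁₂)` (sub-Markov `C₁₃ ≤ C₁₂C₂₃` = four-point log-convexity of the levels, (E90b) `mul_le_mul_outer`) whose
share sum is `(3+a+b−ab)∕((1+a)(1+b)) ≤ (3−√C₁₃)∕(1+√C₁₃) ≤ √2` as soon as `C₁₃⁴ = a_{m+2}a_{m+2k₃}∕a²_{m+1+k₃} ≥ 2∕(k₃+1) ≥ 2∕57` ((E90a)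
`three_shares_le_sqrt_two`).  CONSTANTS ARE SHARP FOR THE METHOD, NOT FOR THE TRUTH: README §4 — the unit-weight share bound `Ψ₃` holds to `k₃ = 64`,
the three-window LP to `k₃ ≈ 450`, the full pointwise LP to `k₃ ≈ 5·10³` (gen 80), so `56`∕`133` are where THIS proof stops, and the weighted three-age
absorption (README §5(1)) is the successor's `k₃ ≈ 113`.  NOT CLAIMED: `k₃ > 56`; k-uniformity (false for the undamped total, gen 80 §4(d)); anything
printed — NOT B12 Thm 2, NOT BetaPertH, NOT continuum, NOT Clay.

WHAT IS PROVED ([folklore]; 0 `def`, 0 sorry; axioms propext ∕ Classical.choice ∕ Quot.sound).  §1 `sum_two_ages`, `sum_three_ages`, `corr_two_ages`,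
`share_hyperbola`; §2 **`total_load_two_ages_le_one`**, **`total_load_three_ages_le_one`**; §3 **`flow_nonneg_three_ages`**, **`flow_nonneg_two_ages`**.
-/
noncomputable section
open Finset

namespace Summit.QuantumFields.BalabanUV.Beta.EriceRemainderEnclosureHistoryAutonomyComparisonAgeCompositionThreeAgesTotalLoad

open Literature.MathematicalPhysics.QuantumFieldTheory.Balaban1983to89
open Literature.MathematicalPhysics.QuantumFieldTheory.Balaban1983to89.T4BetaStationary
open Literature.MathematicalPhysics.QuantumFieldTheory.Balaban1983to89.T4BetaFlowWellPosed
open Summit.QuantumFields.BalabanUV.Beta.EriceRemainderEnclosureHistoryAutonomyOrder (strictAnti_of_memFlow memFlow_tail)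
open Summit.QuantumFields.BalabanUV.Beta.EriceRemainderEnclosureHistoryAutonomyComparisonAffineProfile (increment_anti mul_invSq_add_le)
open Summit.QuantumFields.BalabanUV.Beta.EriceRemainderEnclosureHistoryAutonomyComparisonAgeCompositionThreeAgesFlowReads (invSq_sub_ge_all_reads)
open Summit.QuantumFields.BalabanUV.Beta.EriceRemainderEnclosureHistoryAutonomyComparisonAgeCompositionThreeAgesMassCap (window_ratio_sq_le)
open Summit.QuantumFields.BalabanUV.Beta.EriceRemainderEnclosureHistoryAutonomyComparisonAgeCompositionThreeAgesMassCap (window_load_le_sqrt_two_div_two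
  flow_nonneg_of_window_loads_le_one flow_nonneg_three_ages_of_window_loads)
open Summit.QuantumFields.BalabanUV.Beta.EriceRemainderEnclosureHistoryAutonomyComparisonAgeCompositionShareAlgebra (two_ages_numerics pair_le_one_of_shares three_shares_le_sqrt_two)
open Summit.QuantumFields.BalabanUV.Beta.EriceRemainderEnclosureHistoryAutonomyComparisonAgeCompositionWindowShares (mul_le_mul_outer mul_lt_mul_outer mul_sq_le_from_pin le_sqrt_two_mul load_le_share_mul
  load_le_share)

variable {B : (ℕ → ℝ) → ℝ} {γ b gIR : ℝ} {L : ℕ → ℝ} {K : ℕ} {h g : ℕ → ℝ}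

/-! ## §1 Profiles carried by two or three ages; the correlation bound of two ages; the hyperbola -/

/-- Sums over a profile carried by two ages. [folklore] -/
theorem sum_two_ages {i j : ℕ} (hL2 : ∀ l, l < K → l ≠ i → l ≠ j → L l = 0) (hiK : i < K) (hjK : j < K) (hij : i ≠ j) (u : ℕ → ℝ) :
    ∑ l ∈ range K, L l * u l = L i * u i + L j * u j := by
  have hsub : ({i, j} : Finset ℕ) ⊆ range K := by
    intro l hl
    simp only [mem_insert, mem_singleton] at hl
    rw [mem_range]; rcases hl with rfl | rfl <;> assumption
  rw [← sum_subset hsub (fun l hl hln => by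
    simp only [mem_insert, mem_singleton, not_or] at hln
    rw [hL2 l (mem_range.mp hl) hln.1 hln.2, zero_mul]), sum_pair hij]

/-- Sums over a profile carried by the three ages `1 < k₂ < k₃`. [folklore] -/
theorem sum_three_ages {k₂ k₃ : ℕ} (hL3 : ∀ j, j < K → j ≠ 1 → j ≠ k₂ → j ≠ k₃ → L j = 0) (hk2 : 2 ≤ k₂) (hk23 : k₂ < k₃) (hk3K : k₃ < K)
    (u : ℕ → ℝ) : ∑ l ∈ range K, L l * u l = L 1 * u 1 + L k₂ * u k₂ + L k₃ * u k₃ := by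
  have hsub : ({1, k₂, k₃} : Finset ℕ) ⊆ range K := by
    intro j hj
    simp only [mem_insert, mem_singleton] at hj
    rw [mem_range]; rcases hj with rfl | rfl | rfl <;> omega
  rw [← sum_subset hsub (fun j hj hjn => by
    simp only [mem_insert, mem_singleton, not_or] at hjn
    rw [hL3 j (mem_range.mp hj) hjn.1 hjn.2.1 hjn.2.2, zero_mul])]
  rw [sum_insert (by simp only [mem_insert, mem_singleton]; omega), sum_pair (by omega)]
  ring

/-- **THE CORRELATION OF TWO AGES IS BOUNDED BELOW**: `(√2 − 1)²·h(m+i)h(m+j) ≤ 2·h(m+i+j)²` whenever `1 ≤ i ≤ j ≤ 133·i` (concavity from the pin: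
`i·h(m+i)² ≤ (i+j)h(m+i+j)²`, `j·h(m+j)² ≤ (i+j)h(m+i+j)²`, and `(3 − 2√2)²(i+j)² ≤ 4ij`). [folklore] -/
theorem corr_two_ages (hmono : ∀ u v : ℕ → ℝ, SeqBox γ u → SeqBox γ v → (∀ j, u j ≤ v j) → B u ≤ B v) (hb : 0 < b)
    (hlo : ∀ u, SeqBox γ u → b ≤ B u) (hh : SeqBox γ h) (hf : MemFlow B gIR h) {i j : ℕ} (hi : 1 ≤ i) (hij : i ≤ j)
    (hratio : (j : ℝ) ≤ 133 * i) (m : ℕ) : (Real.sqrt 2 - 1) ^ 2 * (h (m + i) * h (m + j)) ≤ 2 * h (m + i + j) ^ 2 := by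
  have hpos : ∀ n, 0 < h n := fun n => (hh n).1
  have gi := hpos (m + i); have gj := hpos (m + j); have gij := hpos (m + i + j)
  have hs2 : Real.sqrt 2 ^ 2 = 2 := Real.sq_sqrt (by norm_num)
  have hsle : Real.sqrt 2 ≤ 1.5 := by rw [Real.sqrt_le_left (by norm_num)]; norm_num
  have e : (Real.sqrt 2 - 1) ^ 2 = 3 - 2 * Real.sqrt 2 := by nlinarith
  rw [e]
  have h1i : (1 : ℝ) ≤ i := by exact_mod_cast hi
  have hijR : (i : ℝ) ≤ j := by exact_mod_cast hij
  have hci := mul_sq_le_from_pin hmono hb hlo hh hf m i j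
  have hcj := mul_sq_le_from_pin hmono hb hlo hh hf m j i
  rw [show m + j + i = m + i + j by ring] at hcj
  have hnum := two_ages_numerics (lt_of_lt_of_le zero_lt_one h1i) hijR hratio
  have hprod : ((i : ℝ) * h (m + i) ^ 2) * ((j : ℝ) * h (m + j) ^ 2) ≤ (((i : ℝ) + j) * h (m + i + j) ^ 2) * (((j : ℝ) + i) * h (m + i + j) ^ 2) :=
    mul_le_mul hci hcj (by positivity) (by positivity)
  have hsq : ((3 - 2 * Real.sqrt 2) * (h (m + i) * h (m + j))) ^ 2 * (((i : ℝ) + j) ^ 2) ≤ (2 * h (m + i + j) ^ 2) ^ 2 * (((i : ℝ) + j) ^ 2) :=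
    calc ((3 - 2 * Real.sqrt 2) * (h (m + i) * h (m + j))) ^ 2 * (((i : ℝ) + j) ^ 2)
        = ((3 - 2 * Real.sqrt 2) ^ 2 * ((i : ℝ) + j) ^ 2) * (h (m + i) ^ 2 * h (m + j) ^ 2) := by ring
      _ ≤ (4 * (i : ℝ) * j) * (h (m + i) ^ 2 * h (m + j) ^ 2) := mul_le_mul_of_nonneg_right hnum (by positivity)
      _ = 4 * (((i : ℝ) * h (m + i) ^ 2) * ((j : ℝ) * h (m + j) ^ 2)) := by ring
      _ ≤ 4 * ((((i : ℝ) + j) * h (m + i + j) ^ 2) * (((j : ℝ) + i) * h (m + i + j) ^ 2)) := by linarith [hprod]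
      _ = (2 * h (m + i + j) ^ 2) ^ 2 * (((i : ℝ) + j) ^ 2) := by ring
  have hij0' : (0 : ℝ) < (i : ℝ) + j := by linarith
  have hij0 : (0 : ℝ) < ((i : ℝ) + j) ^ 2 := by positivity
  have hsq' : ((3 - 2 * Real.sqrt 2) * (h (m + i) * h (m + j))) ^ 2 ≤ (2 * h (m + i + j) ^ 2) ^ 2 := le_of_mul_le_mul_right hsq hij0
  have hc0 : 0 ≤ 3 - 2 * Real.sqrt 2 := by linarith
  exact (pow_le_pow_iff_left₀ (by positivity) (by positivity) two_ne_zero).mp hsq'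

/-- The two-share hyperbola in closed form: for the window reads `ap + cq` and `aq + cr` of two loaded ages,
`(1 − s)(1 − s') = (q²∕(pr))·s·s'`. [folklore] -/
theorem share_hyperbola {a c p q r : ℝ} (hp : 0 < p) (hr : 0 < r) (hD1 : 0 < a * p + c * q) (hD2 : 0 < a * q + c * r) :
    (1 - a * p / (a * p + c * q)) * (1 - c * r / (a * q + c * r)) = q ^ 2 / (p * r) * (a * p / (a * p + c * q) * (c * r / (a * q + c * r))) := by
  have := hD1.ne'; have := hD2.ne'; have := hp.ne'; have := hr.ne'
  field_simp
  ring

/-! ## §2 The total window load along flows -/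

/-- **ROUTE (N), FIRST ORDER — TWO LOADED AGES: THE TOTAL WINDOW LOAD IS AT MOST `1` ALONG EVERY FLOW.**  `B` an isotone memory on the box `]0,γ]^ℕ`
with floor `b > 0` dominating the profile `L ≥ 0` (`Σ_{k<K} L_k u_k ≤ B(u)`), `h` a box solution from any pin; the profile carried by two ages
`1 ≤ i < j < K` with `j ≤ 133·i`.  Then at every pin `m`: `x_i(m) + x_j(m) = i·L_ih(m+i)³∕2 + j·L_jh(m+j)³∕2 ≤ 1` (the two shares on the hyperbola
`(1−s_i)(1−s_j) = C_{ij}²s_is_j`, §1–§3; `133` is where `(3−2√2)²(i+j)² ≤ 4ij` stops). [folklore] -/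
theorem total_load_two_ages_le_one (hmono : ∀ u v : ℕ → ℝ, SeqBox γ u → SeqBox γ v → (∀ j, u j ≤ v j) → B u ≤ B v)
    (hL : ∀ k, 0 ≤ L k) (hb : 0 < b) (hlo : ∀ u, SeqBox γ u → b ≤ B u) (hdom : ∀ u, SeqBox γ u → ∑ k ∈ range K, L k * u k ≤ B u)
    (hh : SeqBox γ h) (hf : MemFlow B gIR h) {i j : ℕ} (hi : 1 ≤ i) (hij : i < j) (hjK : j < K) (hratio : (j : ℝ) ≤ 133 * i)
    (hL2 : ∀ l, l < K → l ≠ i → l ≠ j → L l = 0) (m : ℕ) :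
    (i : ℝ) * (L i * h (m + i) ^ 3 / 2) + (j : ℝ) * (L j * h (m + j) ^ 3 / 2) ≤ 1 := by
  have hpos : ∀ n, 0 < h n := fun n => (hh n).1
  have hiK : i < K := lt_trans hij hjK
  have hs2 : Real.sqrt 2 ^ 2 = 2 := Real.sq_sqrt (by norm_num)
  have hsle : Real.sqrt 2 ≤ 1.5 := by rw [Real.sqrt_le_left (by norm_num)]; norm_num
  have hsge : (1 : ℝ) ≤ Real.sqrt 2 := by rw [Real.le_sqrt (by norm_num) (by norm_num)]; norm_num
  have hxi0 : 0 ≤ (i : ℝ) * (L i * h (m + i) ^ 3 / 2) := by have := hL i; have := hpos (m + i); positivity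
  have hxj0 : 0 ≤ (j : ℝ) * (L j * h (m + j) ^ 3 / 2) := by have := hL j; have := hpos (m + j); positivity
  -- degenerate profiles: one age alone carries at most √2∕2
  rcases (hL i).eq_or_lt with hLi | hLi
  · have := window_load_le_sqrt_two_div_two hmono hL hb hlo hdom hh hf hjK m
    rw [← hLi]; simp only [zero_mul, zero_div, mul_zero, zero_add]; linarith
  rcases (hL j).eq_or_lt with hLj | hLj
  · have := window_load_le_sqrt_two_div_two hmono hL hb hlo hdom hh hf hiK m
    rw [← hLj]; simp only [zero_mul, zero_div, mul_zero, add_zero]; linarith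
  -- the shares of the two windows
  have hxi := load_le_share_mul hL hb hlo hdom hh hf hiK m
  have hxj := load_le_share_mul hL hb hlo hdom hh hf hjK m
  rw [sum_two_ages hL2 hiK hjK hij.ne, show m + 2 * i = m + i + i by ring] at hxi
  rw [sum_two_ages hL2 hiK hjK hij.ne, show m + 2 * j = m + j + j by ring, show m + j + i = m + i + j by ring] at hxj
  have gii := hpos (m + i + i); have gij := hpos (m + i + j); have gjj := hpos (m + j + j); have gi := hpos (m + i); have gj := hpos (m + j)
  have hDi : 0 < L i * h (m + i + i) + L j * h (m + i + j) := by nlinarith [mul_pos hLi gii, mul_pos hLj gij]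
  have hDj : 0 < L i * h (m + i + j) + L j * h (m + j + j) := by nlinarith [mul_pos hLi gij, mul_pos hLj gjj]
  have hri := le_sqrt_two_mul hmono hb hlo hh hf m i
  have hrj := le_sqrt_two_mul hmono hb hlo hh hf m j
  -- the weights P = √2·h(m+k)∕(2h(m+2k)) ≤ 1
  have hPi : Real.sqrt 2 * h (m + i) / (2 * h (m + i + i)) ≤ 1 := by
    rw [div_le_one (by positivity)]
    calc Real.sqrt 2 * h (m + i) ≤ Real.sqrt 2 * (Real.sqrt 2 * h (m + i + i)) := mul_le_mul_of_nonneg_left hri (Real.sqrt_nonneg 2)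
      _ = 2 * h (m + i + i) := by rw [← mul_assoc, Real.mul_self_sqrt (by norm_num)]
  have hPj : Real.sqrt 2 * h (m + j) / (2 * h (m + j + j)) ≤ 1 := by
    rw [div_le_one (by positivity)]
    calc Real.sqrt 2 * h (m + j) ≤ Real.sqrt 2 * (Real.sqrt 2 * h (m + j + j)) := mul_le_mul_of_nonneg_left hrj (Real.sqrt_nonneg 2)
      _ = 2 * h (m + j + j) := by rw [← mul_assoc, Real.mul_self_sqrt (by norm_num)]
  have hΛ := corr_two_ages hmono hb hlo hh hf hi hij.le hratio m
  -- the two shares and the pure two-share lemma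
  have hsi0 : 0 ≤ L i * h (m + i + i) / (L i * h (m + i + i) + L j * h (m + i + j)) := div_nonneg (by positivity) hDi.le
  have hsi1 : L i * h (m + i + i) / (L i * h (m + i + i) + L j * h (m + i + j)) ≤ 1 :=
    (div_le_one hDi).2 (by nlinarith [mul_pos hLj gij])
  have hsj0 : 0 ≤ L j * h (m + j + j) / (L i * h (m + i + j) + L j * h (m + j + j)) := div_nonneg (by positivity) hDj.le
  have hsj1 : L j * h (m + j + j) / (L i * h (m + i + j) + L j * h (m + j + j)) ≤ 1 :=
    (div_le_one hDj).2 (by nlinarith [mul_pos hLi gij])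
  have hX : Real.sqrt 2 * ((i : ℝ) * (L i * h (m + i) ^ 3 / 2))
      ≤ Real.sqrt 2 * h (m + i) / (2 * h (m + i + i)) * (L i * h (m + i + i) / (L i * h (m + i + i) + L j * h (m + i + j))) :=
    calc Real.sqrt 2 * ((i : ℝ) * (L i * h (m + i) ^ 3 / 2))
        ≤ Real.sqrt 2 * (L i * h (m + i + i) / (L i * h (m + i + i) + L j * h (m + i + j)) * (h (m + i) / (2 * h (m + i + i)))) :=
          mul_le_mul_of_nonneg_left hxi (Real.sqrt_nonneg 2)
      _ = _ := by rw [mul_div_assoc]; ring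
  have hY : Real.sqrt 2 * ((j : ℝ) * (L j * h (m + j) ^ 3 / 2))
      ≤ Real.sqrt 2 * h (m + j) / (2 * h (m + j + j)) * (L j * h (m + j + j) / (L i * h (m + i + j) + L j * h (m + j + j))) :=
    calc Real.sqrt 2 * ((j : ℝ) * (L j * h (m + j) ^ 3 / 2))
        ≤ Real.sqrt 2 * (L j * h (m + j + j) / (L i * h (m + i + j) + L j * h (m + j + j)) * (h (m + j) / (2 * h (m + j + j)))) :=
          mul_le_mul_of_nonneg_left hxj (Real.sqrt_nonneg 2)
      _ = _ := by rw [mul_div_assoc]; ring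
  have hhyp := share_hyperbola (a := L i) (c := L j) gii gjj hDi hDj
  have hρ : (Real.sqrt 2 - 1) ^ 2 * (Real.sqrt 2 * h (m + i) / (2 * h (m + i + i)) * (Real.sqrt 2 * h (m + j) / (2 * h (m + j + j))))
      ≤ h (m + i + j) ^ 2 / (h (m + i + i) * h (m + j + j)) := by
    rw [div_mul_div_comm, mul_div_assoc', div_le_div_iff₀ (by positivity) (by positivity)]
    have e : (Real.sqrt 2 - 1) ^ 2 * (Real.sqrt 2 * h (m + i) * (Real.sqrt 2 * h (m + j))) * (h (m + i + i) * h (m + j + j))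
        = ((Real.sqrt 2 - 1) ^ 2 * (h (m + i) * h (m + j))) * (h (m + i + i) * h (m + j + j)) * Real.sqrt 2 ^ 2 := by ring
    rw [e, hs2]
    nlinarith [mul_le_mul_of_nonneg_right hΛ (show 0 ≤ h (m + i + i) * h (m + j + j) by positivity)]
  exact pair_le_one_of_shares hxi0 hxj0 hPi hPj hsi0 hsi1 hsj0 hsj1 hX hY hhyp hρ


/-- **ROUTE (N), FIRST ORDER — THE THREE LOADED AGES `{1, k₂, k₃}` WITH `k₃ ≤ 56`: `d_m + x₂(m) + x₃(m) ≤ 1` ALONG EVERY FLOW.**  Same memory, profile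
carried by `1 < k₂ < k₃ < K` (`k₂ ≥ 2`, `k₃ ≤ 56`).  The successor target of README g80∕e89 §5(1), by the share functional: `x_i ≤ (√2∕2)·s_i`, the three
self-shares under the sub-Markov kernel `h(m+n_i+n_j)` sum to at most `√2` (§3; `56` is where `C₁₃⁴ ≥ 2∕(k₃+1)` stops serving `(3−√C₁₃)∕(1+√C₁₃) ≤ √2`).
[folklore] -/
theorem total_load_three_ages_le_one (hmono : ∀ u v : ℕ → ℝ, SeqBox γ u → SeqBox γ v → (∀ j, u j ≤ v j) → B u ≤ B v)
    (hL : ∀ k, 0 ≤ L k) (hb : 0 < b) (hlo : ∀ u, SeqBox γ u → b ≤ B u) (hdom : ∀ u, SeqBox γ u → ∑ k ∈ range K, L k * u k ≤ B u)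
    (hh : SeqBox γ h) (hf : MemFlow B gIR h) {k₂ k₃ : ℕ} (hk2 : 2 ≤ k₂) (hk23 : k₂ < k₃) (hk3K : k₃ < K) (hk3 : k₃ ≤ 56)
    (hL3 : ∀ j, j < K → j ≠ 1 → j ≠ k₂ → j ≠ k₃ → L j = 0) (m : ℕ) :
    L 1 * h (m + 1) ^ 3 / 2 + (k₂ : ℝ) * (L k₂ * h (m + k₂) ^ 3 / 2) + (k₃ : ℝ) * (L k₃ * h (m + k₃) ^ 3 / 2) ≤ 1 := by
  have hpos : ∀ n, 0 < h n := fun n => (hh n).1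
  have hanti := (strictAnti_of_memFlow hb hlo hh hf).antitone
  have h1K : 1 < K := by omega
  have hk2K : k₂ < K := lt_trans hk23 hk3K
  have hs2 : Real.sqrt 2 ^ 2 = 2 := Real.sq_sqrt (by norm_num)
  -- the empty profile
  by_cases hzero : L 1 + L k₂ + L k₃ = 0
  · have e1 : L 1 = 0 := by linarith [hL 1, hL k₂, hL k₃]
    have e2 : L k₂ = 0 := by linarith [hL 1, hL k₂, hL k₃]
    have e3 : L k₃ = 0 := by linarith [hL 1, hL k₂, hL k₃]
    rw [e1, e2, e3]; norm_num
  have hl : 0 < L 1 + L k₂ + L k₃ := lt_of_le_of_ne (by linarith [hL 1, hL k₂, hL k₃]) (Ne.symm hzero)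
  -- the three shares
  have hx₁ := load_le_share hmono hL hb hlo hdom hh hf h1K m
  have hx₂ := load_le_share hmono hL hb hlo hdom hh hf hk2K m
  have hx₃ := load_le_share hmono hL hb hlo hdom hh hf hk3K m
  rw [sum_three_ages hL3 hk2 hk23 hk3K, Nat.cast_one, one_mul, show m + 2 * 1 = m + 2 by ring, show m + 1 + 1 = m + 2 by ring] at hx₁
  rw [sum_three_ages hL3 hk2 hk23 hk3K, show m + 2 * k₂ = m + k₂ + k₂ by ring, show m + k₂ + 1 = m + 1 + k₂ by ring] at hx₂
  rw [sum_three_ages hL3 hk2 hk23 hk3K, show m + 2 * k₃ = m + k₃ + k₃ by ring, show m + k₃ + 1 = m + 1 + k₃ by ring,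
    show m + k₃ + k₂ = m + k₂ + k₃ by ring] at hx₃
  -- the kernel conditions along the flow
  obtain ⟨d, hd⟩ : ∃ d, k₂ = d + 1 := ⟨k₂ - 1, by omega⟩
  obtain ⟨e, he⟩ : ∃ e, k₃ = k₂ + e := ⟨k₃ - k₂, by omega⟩
  have hd1 : 1 ≤ d := by omega
  have he1 : 1 ≤ e := by omega
  have hlc12 : h (m + 1 + k₂) ^ 2 < h (m + 2) * h (m + k₂ + k₂) := by
    have := mul_lt_mul_outer hmono hb hlo hh hf (m + 2) hd1 hd1
    rw [show m + 2 + d = m + 1 + k₂ by omega, show m + 1 + k₂ + d = m + k₂ + k₂ by omega] at this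
    nlinarith [this]
  have hlc23 : h (m + k₂ + k₃) ^ 2 < h (m + k₂ + k₂) * h (m + k₃ + k₃) := by
    have := mul_lt_mul_outer hmono hb hlo hh hf (m + k₂ + k₂) he1 he1
    rw [show m + k₂ + k₂ + e = m + k₂ + k₃ by omega, show m + k₂ + k₃ + e = m + k₃ + k₃ by omega] at this
    nlinarith [this]
  have hsub : h (m + 1 + k₃) * h (m + k₂ + k₂) ≤ h (m + 1 + k₂) * h (m + k₂ + k₃) := by
    have := mul_le_mul_outer hmono hb hlo hh hf (m + 1 + k₂) d e
    rw [show m + 1 + k₂ + d = m + k₂ + k₂ by omega, show m + 1 + k₂ + e = m + 1 + k₃ by omega,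
      show m + k₂ + k₂ + e = m + k₂ + k₃ by omega] at this
    linarith
  have ht8 : 2 / 57 * (h (m + 2) ^ 2 * h (m + k₃ + k₃) ^ 2) ≤ h (m + 1 + k₃) ^ 4 := by
    have hc := mul_sq_le_from_pin hmono hb hlo hh hf m 2 (k₃ - 1)
    rw [show m + 2 + (k₃ - 1) = m + 1 + k₃ by omega, Nat.cast_sub (by omega : 1 ≤ k₃)] at hc
    norm_num at hc
    have hk3R : (k₃ : ℝ) ≤ 56 := by exact_mod_cast hk3
    have h57 : ((2 : ℝ) + ((k₃ : ℝ) - 1)) ≤ 57 := by linarith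
    have hA : 2 * h (m + 2) ^ 2 ≤ 57 * h (m + 1 + k₃) ^ 2 := hc.trans (mul_le_mul_of_nonneg_right h57 (sq_nonneg _))
    have hB : h (m + k₃ + k₃) ^ 2 ≤ h (m + 1 + k₃) ^ 2 := pow_le_pow_left₀ (hpos _).le (hanti (by omega)) 2
    have h0 : 0 ≤ h (m + 2) ^ 2 := sq_nonneg _
    nlinarith [mul_le_mul hA hB (sq_nonneg _) (by positivity)]
  have hthree := three_shares_le_sqrt_two (hL 1) (hL k₂) (hL k₃) hl (hpos (m + 2)) (hpos (m + 1 + k₂)) (hpos (m + 1 + k₃)) (hpos (m + k₂ + k₂))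
    (hpos (m + k₂ + k₃)) (hpos (m + k₃ + k₃)) hlc12 hlc23 hsub ht8
  have hhalf : 0 ≤ Real.sqrt 2 / 2 := by positivity
  calc L 1 * h (m + 1) ^ 3 / 2 + (k₂ : ℝ) * (L k₂ * h (m + k₂) ^ 3 / 2) + (k₃ : ℝ) * (L k₃ * h (m + k₃) ^ 3 / 2)
      ≤ Real.sqrt 2 / 2 * (L 1 * h (m + 2) / (L 1 * h (m + 2) + L k₂ * h (m + 1 + k₂) + L k₃ * h (m + 1 + k₃)))
        + Real.sqrt 2 / 2 * (L k₂ * h (m + k₂ + k₂) / (L 1 * h (m + 1 + k₂) + L k₂ * h (m + k₂ + k₂) + L k₃ * h (m + k₂ + k₃)))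
        + Real.sqrt 2 / 2 * (L k₃ * h (m + k₃ + k₃) / (L 1 * h (m + 1 + k₃) + L k₂ * h (m + k₂ + k₃) + L k₃ * h (m + k₃ + k₃))) := by
        linarith
    _ = Real.sqrt 2 / 2 * (L 1 * h (m + 2) / (L 1 * h (m + 2) + L k₂ * h (m + 1 + k₂) + L k₃ * h (m + 1 + k₃))
        + L k₂ * h (m + k₂ + k₂) / (L 1 * h (m + 1 + k₂) + L k₂ * h (m + k₂ + k₂) + L k₃ * h (m + k₂ + k₃))
        + L k₃ * h (m + k₃ + k₃) / (L 1 * h (m + 1 + k₃) + L k₂ * h (m + k₂ + k₃) + L k₃ * h (m + k₃ + k₃))) := by ring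
    _ ≤ Real.sqrt 2 / 2 * Real.sqrt 2 := mul_le_mul_of_nonneg_left hthree hhalf
    _ = 1 := by nlinarith [hs2]

/-! ## §3 The END along every flow -/

/-- **THE THREE-AGE END ALONG EVERY FLOW (`k₃ ≤ 56`), ANY DAMPING, ANY HORIZON.**  (E89b) `flow_nonneg_three_ages_of_window_loads` with its hypothesis
`d + x₂ + x₃ ≤ 1` DISCHARGED by `total_load_three_ages_le_one`: for the isotone dominated memory with floor and the profile carried by `{1, k₂, k₃}`,
`2 ≤ k₂ < k₃ < K`, `k₃ ≤ 56`, the comparison surplus of every admissible excess satisfies `0 ≤ ε ≤ e` at every pin. [folklore] -/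
theorem flow_nonneg_three_ages (hmono : ∀ u v : ℕ → ℝ, SeqBox γ u → SeqBox γ v → (∀ j, u j ≤ v j) → B u ≤ B v)
    (hL : ∀ k, 0 ≤ L k) (hb : 0 < b) (hlo : ∀ u, SeqBox γ u → b ≤ B u) (hdom : ∀ u, SeqBox γ u → ∑ k ∈ range K, L k * u k ≤ B u)
    (hh : SeqBox γ h) (hf : MemFlow B gIR h) (hg : ∀ t, 0 < g t ∧ g t ≤ 1)
    {k₂ k₃ : ℕ} (hk2 : 2 ≤ k₂) (hk23 : k₂ < k₃) (hk3K : k₃ < K) (hk3 : k₃ ≤ 56) (hL3 : ∀ j, j < K → j ≠ 1 → j ≠ k₂ → j ≠ k₃ → L j = 0)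
    {N : ℕ} (hKN : K ≤ N) {KL : ℕ → ℕ → ℕ → ℝ}
    (hKL : ∀ k n l, KL k n l = if 0 < k ∧ k < K ∧ l < k then L k * h (n + k) ^ 3 / 2 * ∏ t ∈ Ico (n + 1 + l) (n + k + 1), g t else 0)
    {KA : ℕ → ℕ → ℕ → ℝ} {RA : ℕ → (ℕ → ℝ) → ℕ → ℝ}
    (hRA : ∀ i v m, RA i v m = ∑ l ∈ range K, KA i m l * v (m + 1 + l))
    (hKA : ∀ i m l, KA i m l = KL i m l + KA (i + 1) m l) (hKAtop : ∀ m l, KA K m l = 0)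
    {e ε : ℕ → ℝ} (he0 : ∀ m, 0 ≤ e m) (hea : ∀ m, e (m + 1) ≤ e m)
    (hεt : ∀ m, N < m → ε m = 0) (hεrec : ∀ m, ε m = e m - RA 1 ε m) : ∀ m, 0 ≤ ε m ∧ ε m ≤ e m :=
  flow_nonneg_three_ages_of_window_loads hL hh hg hk2 hk23 hk3K hL3 hKN hKL hRA hKA hKAtop
    (d := fun m => L 1 * h (m + 1) ^ 3 / 2) (x₂ := fun m => (k₂ : ℝ) * (L k₂ * h (m + k₂) ^ 3 / 2))
    (x₃ := fun m => (k₃ : ℝ) * (L k₃ * h (m + k₃) ^ 3 / 2)) (fun _ => rfl) (fun _ => rfl) (fun _ => rfl)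
    (fun m => total_load_three_ages_le_one hmono hL hb hlo hdom hh hf hk2 hk23 hk3K hk3 hL3 m) he0 hea hεt hεrec

/-- **THE TWO-AGE END ALONG EVERY FLOW (`j ≤ 133·i`), ANY DAMPING, ANY HORIZON** ((E89b) `flow_nonneg_of_window_loads_le_one` discharged by
`total_load_two_ages_le_one`). [folklore] -/
theorem flow_nonneg_two_ages (hmono : ∀ u v : ℕ → ℝ, SeqBox γ u → SeqBox γ v → (∀ j, u j ≤ v j) → B u ≤ B v)
    (hL : ∀ k, 0 ≤ L k) (hb : 0 < b) (hlo : ∀ u, SeqBox γ u → b ≤ B u) (hdom : ∀ u, SeqBox γ u → ∑ k ∈ range K, L k * u k ≤ B u)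
    (hh : SeqBox γ h) (hf : MemFlow B gIR h) (hg : ∀ t, 0 < g t ∧ g t ≤ 1)
    {i j : ℕ} (hi : 1 ≤ i) (hij : i < j) (hjK : j < K) (hratio : (j : ℝ) ≤ 133 * i) (hL2 : ∀ l, l < K → l ≠ i → l ≠ j → L l = 0)
    {N : ℕ} (hKN : K ≤ N) {KL : ℕ → ℕ → ℕ → ℝ}
    (hKL : ∀ k n l, KL k n l = if 0 < k ∧ k < K ∧ l < k then L k * h (n + k) ^ 3 / 2 * ∏ t ∈ Ico (n + 1 + l) (n + k + 1), g t else 0)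
    {KA : ℕ → ℕ → ℕ → ℝ} {RA : ℕ → (ℕ → ℝ) → ℕ → ℝ}
    (hRA : ∀ i v m, RA i v m = ∑ l ∈ range K, KA i m l * v (m + 1 + l))
    (hKA : ∀ i m l, KA i m l = KL i m l + KA (i + 1) m l) (hKAtop : ∀ m l, KA K m l = 0)
    {e ε : ℕ → ℝ} (he0 : ∀ m, 0 ≤ e m) (hea : ∀ m, e (m + 1) ≤ e m)
    (hεt : ∀ m, N < m → ε m = 0) (hεrec : ∀ m, ε m = e m - RA 1 ε m) : ∀ m, 0 ≤ ε m ∧ ε m ≤ e m := by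
  have hiK : i < K := lt_trans hij hjK
  refine flow_nonneg_of_window_loads_le_one hL hh hg (by omega) hKN hKL hRA hKA hKAtop (fun m => ?_) he0 hea hεt hεrec
  have e : ∑ k ∈ range K, (k : ℝ) * (L k * h (m + k) ^ 3 / 2) = ∑ k ∈ range K, L k * ((k : ℝ) * h (m + k) ^ 3 / 2) :=
    sum_congr rfl fun k _ => by ring
  rw [e, sum_two_ages hL2 hiK hjK hij.ne]
  have := total_load_two_ages_le_one hmono hL hb hlo hdom hh hf hi hij hjK hratio hL2 m
  linarith

end Summit.QuantumFields.BalabanUV.Beta.EriceRemainderEnclosureHistoryAutonomyComparisonAgeCompositionThreeAgesTotalLoad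

end
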